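import Summits.NavierStokesRegularity.NavierStokesRegularity.Theorems.SoloSalvageLindgren2012Enstrophy
import Literature.Claims.NS.LucardoOlivaes2026
import Literature.Analysis.FluidPDE.EnstrophyGronwall
import HarnessLib

/-!
# Solo salvage for claim C137 `LucardoOlivaes2026`, part 2 (cell `ns-claims`, D-0090): the enstrophy
# identity (5) is TRUE in its classical (Frobenius) form, and the GI composition of record runs
# without hypothesising Step 5

Claim C137: skeleton `Literature.Claims.NS.LucardoOlivaes2026` (typist-10 g4). Its Step 5 (display (5) p.2
l.27–43, «½ d/dt‖ω‖² = ∫ω·(ω·∇)u − ν‖∇ω‖²») is typed as `Step5_EnstrophyId` with the palinstrophy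
`vortgradsq u t = ∫‖D(curl u(t))(x)‖²_{op}` (OPERATOR norm of the Fréchet derivative). The classical identity
carries the Frobenius (Hilbert–Schmidt) norm `Σᵢ‖∂ᵢω‖² = frobeniusNormSq (Dω)`; this file proves THAT
identity along every regular solution of the skeleton's class and re-runs the paper's composition on it:

* `hasDerivAt_half_ensq` — for `ν > 0` and every `IsLocalSolution ν T v₀ u p`, at every `t ∈ (0,T)`:
  `HasDerivAt (s ↦ ½·ensq u s) (stretchI (u t) − ν·∫ frobeniusNormSq (D(curl u(t)) x)) t`. Bridge: a
  Chae-class solution on `[0,T)` is a Ruzmaikina/Lindgren closed-slab solution on every `[0,T'']`, `T'' < T`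
  (`isSolutionOn_of_isLocalSolution`); salvage-p3's pointwise enstrophy evolution
  `Lindgren2012Salvage.lindgren2012_step3_holds` (derivative `2(stretchPerp + ν·dissip)` within `[0,T'']`),
  made two-sided at interior times, with `stretchPerp = stretch = ∫⟪ω,(∇u)ω⟫ = stretchI`
  (`stretchPerp_eq`, `integral_stretching_eq_stretch`) and `dissip = −∫|∇ω|²_F`
  (`dissip_eq_neg_integral_frobeniusNormSq`).
* `vortgradsq_eq_of_step5` — the typed face `Step5_EnstrophyId` forces, by uniqueness of derivatives,
  `∫‖∇ω(t)‖²_{op} = ∫|∇ω(t)|²_F` at every interior time of every solution of the class: the precise sense in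
  which the typed (operator-norm) display is stronger than the classical identity (records-grade; no class
  consequence — (5) is not the located step).
* `integral_frobeniusNormSq_le_three_mul_vortgradsq` — `∫|∇ω|²_F ≤ 3·vortgradsq` (`|A|²_F ≤ 3‖A‖²_op`).
* `diffIneq7_of_stretchLower` — a per-datum stretching lower bound (the content of (6)) gives the
  differential inequality (7) with dissipation coefficient `6ν` UNCONDITIONALLY in Step 5; hence
  `diffIneq7_of_step6GI` and **`claim_of_stepsGI_of_enstrophy : Step3GI_Datum → Step6GI_StretchLower →
  Step7_DissipRate → Step9_Reduction8 → Step10_Divergence → ClaimedTheorem`** — the skeleton's composition of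
  record `claim_of_stepsGI` with its Step-5 premise discharged in the kernel (Step 9 accepts any `c ≥ 0`).

Salvage seat `ns-claims-salvage-p4` g3 (solo lane; no statement item). Nothing disputed is asserted: the
located step of record stays `Step6GI_StretchLower` (class unfilled gap, ADJUDICATED #120); no skeleton
declaration, locator or class is touched.

WHAT THIS IS NOT: not a claim about NS regularity or blow-up; not a claim about any author beyond the typed
locator.
-/

-- The summit's canonical theorem namespace repeats the summit name (single-conjunct summit).
set_option linter.dupNamespace false

noncomputable section

open Set Filter MeasureTheory
open _root_.Topology
open scoped ENNReal NNReal ContDiff RealInnerProductSpace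

namespace Summit.NavierStokesRegularity.NavierStokesRegularity.Theorems.LucardoOlivaes2026

open Literature.Analysis.FluidPDE
open Literature.Claims.NS.Chae2007 (IsLocalSolution)
open Literature.Claims.NS.LucardoOlivaes2026
open Literature.Claims.NS.Lindgren2012 (enstrophy stretchPerp stretch dissip stretchPerp_eq)
open Summit.NavierStokesRegularity.NavierStokesRegularity.Theorems.Lindgren2012Salvage
  (lindgren2012_step3_holds integral_stretching_eq_stretch dissip_eq_neg_integral_frobeniusNormSq)

/-! ## 1. The bridge to the closed-slab class and the classical enstrophy identity -/

/-- **A regular solution on `[0,T)` (Chae class) is a closed-slab solution on every `[0,T'']`, `0 < T'' < T`**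
(Ruzmaikina/Lindgren `IsSolutionOn`: classical on the slab, all `L²` Sobolev norms bounded). [folklore] -/
theorem isSolutionOn_of_isLocalSolution {ν T T'' : ℝ} {v₀ : E3 → E3} {u : ℝ → E3 → E3} {p : ℝ → E3 → ℝ}
    (h : IsLocalSolution ν T v₀ u p) (h0 : 0 < T'') (hT'' : T'' < T) :
    Literature.Claims.NS.Ruzmaikina2008.IsSolutionOn ν 0 T'' u p :=
  ⟨h.isClassical.mono (Icc_subset_Ico_right hT'') (uniqueDiffOn_Icc h0), h.sobolev T'' hT''⟩

/-- **The enstrophy identity (5) in its classical form**: along every regular solution of the class with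
`ν > 0`, at every interior time `t ∈ (0,T)`,
`d/dt (½∫|ω|²) = ∫⟪ω,(∇u)ω⟫ − ν∫|∇ω|²_F` (Frobenius palinstrophy).
[cite: LucardoOlivaes2026, (5) p.2 l.27–43] [cite: MajdaBertozziCUP2002, §3.1.1 p. 87–88] -/
theorem hasDerivAt_half_ensq {ν T : ℝ} (hν : 0 < ν) {v₀ : E3 → E3} {u : ℝ → E3 → E3} {p : ℝ → E3 → ℝ}
    (h : IsLocalSolution ν T v₀ u p) {t : ℝ} (ht : t ∈ Ioo 0 T) :
    HasDerivAt (fun s => (1 / 2 : ℝ) * ensq u s)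
      (stretchI (u t) - ν * ∫ x, frobeniusNormSq (fderiv ℝ (curl (u t)) x)) t := by
  -- a closed slab `[0, T'']` with `t < T'' < T`
  have htT'' : t < (t + T) / 2 := by linarith [ht.2]
  have hT''T : (t + T) / 2 < T := by linarith [ht.2]
  have hT''0 : 0 < (t + T) / 2 := ht.1.trans htT''
  have hsol := isSolutionOn_of_isLocalSolution h hT''0 hT''T
  have htI : t ∈ Icc 0 ((t + T) / 2) := ⟨ht.1.le, htT''.le⟩
  -- the pointwise enstrophy evolution on the slab, two-sided at the interior time `t`
  have hW := lindgren2012_step3_holds ν ((t + T) / 2) u p hν hT''0 hsol t htI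
  have hD : HasDerivAt (fun s => enstrophy (u s)) (2 * (stretchPerp (u t) + ν * dissip (u t))) t :=
    hW.hasDerivAt (Icc_mem_nhds ht.1 htT'')
  -- identify the two terms
  have hS : IsClassicalNSSolutionOn (Icc 0 ((t + T) / 2)) ν 0 u p := hsol.isClassical
  have hB : HasBoundedSobolevNormsOn (Icc 0 ((t + T) / 2)) u := hsol.sobolev
  have hsm : ContDiff ℝ ∞ (u t) := hS.contDiff_velocity htI
  obtain ⟨B₀, hB₀⟩ := linfty_bound_of_hasBoundedSobolevNormsOn_holds
    (fun s hs => (hS.contDiff_velocity hs).of_le (by norm_cast)) hB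
  obtain ⟨B₁, -, hB₁⟩ := exists_forall_norm_fderiv_le_of_hasBoundedSobolevNormsOn
    (fun s hs => (hS.contDiff_velocity hs).of_le (by norm_cast)) hB
  have hfin : ∀ n : ℕ, ∫⁻ x, ‖iteratedFDeriv ℝ n (u t) x‖ₑ ^ 2 < ⊤ := fun n => by
    obtain ⟨C, hC⟩ := hB n
    exact (hC t htI).trans_lt ENNReal.coe_lt_top
  have h1 : stretchPerp (u t) = stretchI (u t) := by
    rw [stretchPerp_eq, ← integral_stretching_eq_stretch hsm (hS.divFree t htI) (hB₀ t htI) (hB₁ t htI)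
      (hfin 1) (hfin 2)]
    rfl
  have h2 : dissip (u t) = -∫ x, frobeniusNormSq (fderiv ℝ (curl (u t)) x) :=
    dissip_eq_neg_integral_frobeniusNormSq hsm (hfin 1) (hfin 2) (hfin 3)
  have hD' := hD.const_mul (1 / 2 : ℝ)
  have hfun : (fun s => (1 / 2 : ℝ) * ensq u s) = fun s => (1 / 2 : ℝ) * enstrophy (u s) := rfl
  rw [hfun]
  refine hD'.congr_deriv ?_
  rw [h1, h2]
  ring

/-- **What the typed face adds**: `Step5_EnstrophyId` (palinstrophy with the OPERATOR norm) forces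
`∫‖∇ω(t)‖²_{op} = ∫|∇ω(t)|²_F` at every interior time of every regular solution of the class (uniqueness of
the derivative against `hasDerivAt_half_ensq`). Records-grade. [cite: LucardoOlivaes2026, (5) p.2 l.27–43] -/
theorem vortgradsq_eq_of_step5 (h5 : Step5_EnstrophyId) {ν T : ℝ} (hν : 0 < ν) {v₀ : E3 → E3}
    {u : ℝ → E3 → E3} {p : ℝ → E3 → ℝ} (h : IsLocalSolution ν T v₀ u p) {t : ℝ} (ht : t ∈ Ioo 0 T) :
    vortgradsq u t = ∫ x, frobeniusNormSq (fderiv ℝ (curl (u t)) x) := by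
  have huniq := (h5 ν hν T v₀ u p h t ht).unique (hasDerivAt_half_ensq hν h ht)
  have hν0 : ν ≠ 0 := hν.ne'
  have : ν * vortgradsq u t = ν * ∫ x, frobeniusNormSq (fderiv ℝ (curl (u t)) x) := by linarith
  exact mul_left_cancel₀ hν0 this

/-! ## 2. Frobenius versus operator palinstrophy, and (7) with coefficient `6ν` -/

/-- `∫|∇ω(t)|²_F ≤ 3·∫‖∇ω(t)‖²_{op}` along a regular solution (`|A|²_F ≤ 3‖A‖²` on `ℝ³`; the operator
palinstrophy is integrable in the class: `‖D(curl v)‖ ≤ ‖curl‖·‖D²v‖`, `D²v ∈ L²`). [folklore] -/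
theorem integral_frobeniusNormSq_le_three_mul_vortgradsq {ν T : ℝ} {v₀ : E3 → E3} {u : ℝ → E3 → E3}
    {p : ℝ → E3 → ℝ} (h : IsLocalSolution ν T v₀ u p) {t : ℝ} (ht : t ∈ Ico 0 T) :
    ∫ x, frobeniusNormSq (fderiv ℝ (curl (u t)) x) ≤ 3 * vortgradsq u t := by
  have hsm : ContDiff ℝ ∞ (u t) := h.isClassical.contDiff_velocity ht
  have h2 : ContDiff ℝ 2 (u t) := hsm.of_le (by norm_cast)
  -- a closed slab containing `t` for the Sobolev bound
  have hT''T : (t + T) / 2 < T := by linarith [ht.2]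
  have htI : t ∈ Icc 0 ((t + T) / 2) := ⟨ht.1, by linarith [ht.2]⟩
  have hfin2 : ∫⁻ x, ‖iteratedFDeriv ℝ 2 (u t) x‖ₑ ^ 2 < ⊤ := by
    obtain ⟨C, hC⟩ := h.sobolev _ hT''T 2
    exact (hC t htI).trans_lt ENNReal.coe_lt_top
  have i2 : Integrable fun x => ‖iteratedFDeriv ℝ 2 (u t) x‖ ^ 2 :=
    integrable_sq_norm_of_lintegral_lt_top (hsm.continuous_iteratedFDeriv (by norm_cast)) hfin2
  have hcont : Continuous fun x => fderiv ℝ (curl (u t)) x :=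
    (contDiff_curl (n := 1) h2).continuous_fderiv (by simp)
  have iop : Integrable fun x => ‖fderiv ℝ (curl (u t)) x‖ ^ 2 := by
    refine (i2.const_mul (‖curlCLM‖ ^ 2)).mono' (hcont.norm.pow 2).aestronglyMeasurable
      (Eventually.of_forall fun x => ?_)
    rw [Real.norm_eq_abs, abs_of_nonneg (sq_nonneg _)]
    calc ‖fderiv ℝ (curl (u t)) x‖ ^ 2 ≤ (‖curlCLM‖ * ‖iteratedFDeriv ℝ 2 (u t) x‖) ^ 2 :=
          pow_le_pow_left₀ (norm_nonneg _) (norm_fderiv_curl_le h2 x) 2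
      _ = ‖curlCLM‖ ^ 2 * ‖iteratedFDeriv ℝ 2 (u t) x‖ ^ 2 := by ring
  unfold vortgradsq
  rw [← integral_const_mul]
  exact integral_mono_of_nonneg (Eventually.of_forall fun x => frobeniusNormSq_nonneg _)
    (iop.const_mul 3) (Eventually.of_forall fun x => frobeniusNormSq_le_three_mul _)

/-- **(7) with dissipation coefficient `6ν` from a stretching lower bound alone**: if one constant
`C₁ > 0` serves (6) along every regular solution from `v₀` (the content of Step 6 for this datum), then
`d/dt‖ω‖² ≥ 2C₁‖ω‖_∞‖ω‖² − 6ν‖∇ω‖²_{op}` at interior times (`DiffIneq7 ν (6ν) v₀`) — the enstrophy identity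
being supplied by `hasDerivAt_half_ensq`, the factor `3` by `integral_frobeniusNormSq_le_three_mul_vortgradsq`.
[cite: LucardoOlivaes2026, (5)–(7) p.2] -/
theorem diffIneq7_of_stretchLower {ν : ℝ} (hν : 0 < ν) {v₀ : E3 → E3} {C₁ : ℝ} (hC₁ : 0 < C₁)
    (H6 : ∀ (T : ℝ) (u : ℝ → E3 → E3) (p : ℝ → E3 → ℝ), IsLocalSolution ν T v₀ u p →
      ∀ t ∈ Ico 0 T, C₁ * supVort u t * ensq u t ≤ stretchI (u t)) :
    DiffIneq7 ν (6 * ν) v₀ := by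
  refine ⟨2 * C₁, by positivity, fun T u p hsol t ht => ?_⟩
  have hd := (hasDerivAt_half_ensq hν hsol ht).const_mul (2 : ℝ)
  have hfun : (fun y => 2 * ((1 / 2 : ℝ) * ensq u y)) = ensq u := by
    funext s
    ring
  rw [hfun] at hd
  refine ⟨_, hd, ?_⟩
  have h6t := H6 T u p hsol t ⟨ht.1.le, ht.2⟩
  have hF := mul_le_mul_of_nonneg_left
    (integral_frobeniusNormSq_le_three_mul_vortgradsq hsol ⟨ht.1.le, ht.2⟩) hν.le
  linarith

/-- (7) with coefficient `6ν` on the class of record (printed geometry, integrated alignment) from the token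
step alone. [cite: LucardoOlivaes2026, (6)–(7) p.2] -/
theorem diffIneq7_of_step6GI (h6 : Step6GI_StretchLower) {ν : ℝ} (hν : 0 < ν) {v₀ : E3 → E3}
    (hD : IsOuroDatum v₀) (hG : IsOuroGeometry v₀) (hA : IsAlignedDatumI v₀) : DiffIneq7 ν (6 * ν) v₀ := by
  obtain ⟨C₁, hC₁, H6⟩ := h6 ν hν v₀ hD hG hA
  exact diffIneq7_of_stretchLower hν hC₁ H6

/-- (7) with coefficient `6ν` on the analytic class from the solution-grain Step 6 alone (that premise is
kernel-false, `not_Step6_StretchLower`; recorded for the literal chain). [cite: LucardoOlivaes2026, (6)–(7) p.2] -/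
theorem diffIneq7_of_step6 (h6 : Step6_StretchLower) {ν : ℝ} (hν : 0 < ν) {v₀ : E3 → E3}
    (hD : IsOuroDatum v₀) : DiffIneq7 ν (6 * ν) v₀ := by
  obtain ⟨C₁, hC₁, H6⟩ := h6 ν hν v₀ hD
  exact diffIneq7_of_stretchLower hν hC₁ H6

/-! ## 3. The composition of record without the Step-5 hypothesis -/

/-- **COMPOSITION OF RECORD WITH STEP 5 DISCHARGED**: §3 at the I-grain, (6) on the I-class (the located
step), §5's rate sentence, the §6 reduction and the divergence sentence give the claimed statement — the
skeleton's `claim_of_stepsGI` with the enstrophy identity supplied by the kernel (`hasDerivAt_half_ensq`,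
coefficient `6ν`, admissible in Step 9 for any `c ≥ 0`). [cite: LucardoOlivaes2026, §§3–6 pp.2–3] -/
theorem claim_of_stepsGI_of_enstrophy (h3 : Step3GI_Datum) (h6 : Step6GI_StretchLower)
    (h7 : Step7_DissipRate) (h9 : Step9_Reduction8) (h10 : Step10_Divergence) : ClaimedTheorem := by
  intro ν hν
  obtain ⟨v₀, hD, hG, hA⟩ := h3
  have h7' : DiffIneq7 ν (6 * ν) v₀ := diffIneq7_of_step6GI h6 hν hD hG hA
  have h8 : ODE8 ν v₀ := h9 ν hν v₀ hD (6 * ν) (by positivity) h7' (h7 ν hν v₀ hD)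
  exact ⟨v₀, hD, h10 ν hν v₀ hD h8⟩

/-! ## 4. Step 4: the vorticity equation (3) along the class (appended 2026-08-27, salvage-p4 g3) -/

/-- **C137 Step 4 holds — the vorticity equation (3) p.2 l.1–4 along every regular solution of the
class**: `∂ₜω + (u·∇)ω = (ω·∇)u + νΔω` on `[0,T) × ℝ³` with the one-sided time derivative within `[0,T)`
(`ω = ∇ × u`; the curl of (1): tree `IsClassicalNSSolutionOn.isVorticitySolutionOn_of_uniqueDiffOn` on the
half-open slab, force `0`). Nothing above is touched.
[cite: LucardoOlivaes2026, (3) p.2 l.1–4] [cite: MajdaBertozziCUP2002, §1.4 (1.33), Prop. 2.21] -/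
theorem step4_VorticityEq_holds : Step4_VorticityEq := by
  intro ν _hν T v₀ u p hsol t ht x
  have hV := hsol.isClassical.isVorticitySolutionOn_of_uniqueDiffOn (uniqueDiffOn_Ico 0 T)
    (fun s _ y => curl_zero y)
  exact hV.vorticity_eq t ht x

end Summit.NavierStokesRegularity.NavierStokesRegularity.Theorems.LucardoOlivaes2026

end
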